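import Summits.CriticalPhenomena.PercolationContinuityZ3.Theorems.PercNearOneGluingNoHeavyLowerTailKNGoodTwoMarkFilter
import HarnessLib

/-!
# `NoHeavyLowerTail` (stmt-CriticalPhenomena-4575) — the two-mark inequality (II): reduction to `o`-blind up-families
# (prim-hp-2 gen 29, MEMO-gen29 §6(b))

Support file (`--supports stmt-CriticalPhenomena-4575`, hull-port prover `prim-hp-2`, gen 29).  No definitions, no
named facts, no sorries; standard axioms.

Setting (MEMO-gen26 §3): Bernoulli bond percolation `μ = prodBernoulli w`, vertices `s` (source), `x` (avoided),
`o`, `a` (marks), `R = {s ↮ x}`, `O = {s ~ o}`, `A = {s ~ a}`; the conjectured inequality (II) for an up-family `𝒰`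
of vertex sets, in the denominator-free shape used throughout (`…KNGoodTwoMarkFilter`, `…Dominance.tilt_weaken`)
with an abstract constant `κ = n/d`:
  `μ(R∩O)·μ(R∩E)·d + n·μ(R∩A∩E)·μ(R) ≤ μ(R∩O∩E)·μ(R)·d + n·μ(R∩A)·μ(R∩E)`,  `E = {C_s ∈ 𝒰}`,
i.e. `Cov_Q(1_O, 1_E) ≥ κ · Cov_Q(1_A, 1_E)`, `Q = μ(·|R)`.
THIS FILE proves that it suffices to establish (II) for `o`-BLIND up-families: for every up-family `𝒰` the
family `𝒰ₒ = {W : W ∖ {o} ∈ 𝒰}` is again an up-family, its event `Eₒ = {C_s ∖ {o} ∈ 𝒰}` does not see whether `o`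
itself is in the cluster, and (II) for `Eₒ` implies (II) for `E`, provided the constant satisfies the (always true
for `κ_M`, by `phi_one`) side condition `Q(o ∈ C_s) + Q(a ∉ C_s)·κ ≤ 1`:

* `KNGoodTwoMark.oblind_core` — the bookkeeping for an arbitrary finite measure and abstract events
  (`Eₒ ⊆ E`, `E ∖ Eₒ ⊆ O`, side condition) ;
* `KNGoodTwoMark.ta_le_one` — the side condition for `κ_M = μ(o~a | M)`:
  `μ(R∩O)·μ(M) + μ({s↮a}∩{s↮x})·μ(M∩{a~o}) ≤ μ(R)·μ(M)` (from `phi_one`);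
* `KNGoodTwoMark.oblind_reduction` — (II) with `κ_M` for `{C_s ∖ {o} ∈ 𝒰}` implies (II) with `κ_M` for `{C_s ∈ 𝒰}`.
[cite: VandenbergHaggstromKahn2005, Thms. 1.1–1.5 (pp. 3–8)] [cite: KozmaNitzan2024, §2.2 Lemmas 1–2 (pp. 5–6), §3 (pp. 7–12)]
-/

noncomputable section

namespace Summit.CriticalPhenomena.PercolationContinuityZ3.Theorems

open MeasureTheory Set Literature.Probability.LatticeModels Literature.Probability.Percolation
open scoped Classical

namespace KNGoodTwoMark

variable {V : Type*} [Fintype V]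

/-- **`o`-blind reduction, abstract bookkeeping.**  For a finite measure `μ` and events `R, O, A, E, Eₒ` with
`Eₒ ⊆ E` and `E ∖ Eₒ ⊆ O`, a constant `n ≥ 0`, any `d`, with the side condition `μ(R∩O)·d + μ(R∩Aᶜ)·n ≤ μ(R)·d`:
(II) for `Eₒ` implies (II) for `E` (shape of `tilt_weaken`). [folklore bookkeeping] -/
theorem oblind_core (μ : Measure (BondConfig V)) [IsFiniteMeasure μ] (R O A E Eo : Set (BondConfig V))
    (hsub : Eo ⊆ E) (hN : E \ Eo ⊆ O) {n d : ℝ} (hn : 0 ≤ n)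
    (ht : μ.real (R ∩ O) * d + μ.real (R ∩ Aᶜ) * n ≤ μ.real R * d)
    (h : μ.real (R ∩ O) * μ.real (R ∩ Eo) * d + n * μ.real (R ∩ (A ∩ Eo)) * μ.real R ≤
      μ.real (R ∩ (O ∩ Eo)) * μ.real R * d + n * μ.real (R ∩ A) * μ.real (R ∩ Eo)) :
    μ.real (R ∩ O) * μ.real (R ∩ E) * d + n * μ.real (R ∩ (A ∩ E)) * μ.real R ≤
      μ.real (R ∩ (O ∩ E)) * μ.real R * d + n * μ.real (R ∩ A) * μ.real (R ∩ E) := by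
  -- the new part `N = E \ Eo`, and its `R`-mass `ν`
  set N : Set (BondConfig V) := E \ Eo with hNdef
  -- decompositions along `Eo`
  have hE1 : R ∩ E ∩ Eo = R ∩ Eo := by
    ext ω; simp only [Set.mem_inter_iff]
    constructor
    · rintro ⟨⟨hr, _⟩, ho⟩; exact ⟨hr, ho⟩
    · rintro ⟨hr, ho⟩; exact ⟨⟨hr, hsub ho⟩, ho⟩
  have hE2 : R ∩ E ∩ Eoᶜ = R ∩ N := by
    ext ω; simp only [hNdef, Set.mem_inter_iff, Set.mem_compl_iff, Set.mem_sdiff]; tauto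
  have hRE : μ.real (R ∩ E) = μ.real (R ∩ Eo) + μ.real (R ∩ N) := by
    rw [real_split μ (R ∩ E) Eo, hE1, hE2]
  have hOE1 : R ∩ (O ∩ E) ∩ Eo = R ∩ (O ∩ Eo) := by
    ext ω; simp only [Set.mem_inter_iff]
    constructor
    · rintro ⟨⟨hr, ho, _⟩, heo⟩; exact ⟨hr, ho, heo⟩
    · rintro ⟨hr, ho, heo⟩; exact ⟨⟨hr, ho, hsub heo⟩, heo⟩
  have hOE2 : R ∩ (O ∩ E) ∩ Eoᶜ = R ∩ N := by
    ext ω; simp only [hNdef, Set.mem_inter_iff, Set.mem_compl_iff, Set.mem_sdiff]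
    constructor
    · rintro ⟨⟨hr, _, he⟩, heo⟩; exact ⟨hr, he, heo⟩
    · rintro ⟨hr, he, heo⟩
      exact ⟨⟨hr, hN ⟨he, heo⟩, he⟩, heo⟩
  have hROE : μ.real (R ∩ (O ∩ E)) = μ.real (R ∩ (O ∩ Eo)) + μ.real (R ∩ N) := by
    rw [real_split μ (R ∩ (O ∩ E)) Eo, hOE1, hOE2]
  have hAE1 : R ∩ (A ∩ E) ∩ Eo = R ∩ (A ∩ Eo) := by
    ext ω; simp only [Set.mem_inter_iff]
    constructor
    · rintro ⟨⟨hr, ha, _⟩, heo⟩; exact ⟨hr, ha, heo⟩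
    · rintro ⟨hr, ha, heo⟩; exact ⟨⟨hr, ha, hsub heo⟩, heo⟩
  have hAE2 : R ∩ (A ∩ E) ∩ Eoᶜ ⊆ R ∩ N := by
    intro ω hω
    simp only [hNdef, Set.mem_inter_iff, Set.mem_compl_iff, Set.mem_sdiff] at hω ⊢
    exact ⟨hω.1.1, hω.1.2.2, hω.2⟩
  have hRAE : μ.real (R ∩ (A ∩ E)) ≤ μ.real (R ∩ (A ∩ Eo)) + μ.real (R ∩ N) := by
    rw [real_split μ (R ∩ (A ∩ E)) Eo, hAE1]
    have := measureReal_mono (μ := μ) hAE2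
    linarith
  -- `μ(R ∩ Aᶜ) = μ(R) - μ(R ∩ A)`
  have hRA : μ.real (R ∩ Aᶜ) = μ.real R - μ.real (R ∩ A) := by
    have := real_split μ R A; linarith
  -- nonnegativity
  have h0 : 0 ≤ μ.real (R ∩ N) := measureReal_nonneg
  have h1 : 0 ≤ μ.real R := measureReal_nonneg
  have h2 : 0 ≤ μ.real (R ∩ O) := measureReal_nonneg
  have h3 : 0 ≤ μ.real (R ∩ A) := measureReal_nonneg
  -- the new mass pays for itself: ν · [μ(R∩O)·d + n·(μ R - μ(R∩A))] ≤ ν · μ(R)·d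
  have hside : μ.real (R ∩ N) * (μ.real (R ∩ O) * d + (μ.real R - μ.real (R ∩ A)) * n) ≤
      μ.real (R ∩ N) * (μ.real R * d) := by
    apply mul_le_mul_of_nonneg_left _ h0
    rw [← hRA]; exact ht
  -- the `A`-term only decreases when `μ(R∩(A∩E))` is replaced by its upper bound
  have hAterm : n * μ.real (R ∩ (A ∩ E)) * μ.real R ≤
      n * (μ.real (R ∩ (A ∩ Eo)) + μ.real (R ∩ N)) * μ.real R := by
    apply mul_le_mul_of_nonneg_right _ h1
    exact mul_le_mul_of_nonneg_left hRAE hn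
  rw [hRE, hROE]
  nlinarith [hside, hAterm, h, h0, h1, h2, h3, hn]

/-- **The side condition `t_a ≤ 1` for `κ_M`:** with `R = {s↮x}`, `K = {s↮a} ∩ {s↮x}`, `M = K ∩ {a↮x}`,
`μ(R ∩ {s~o}) · μ(M) + μ(K) · μ(M ∩ {a~o}) ≤ μ(R) · μ(M)`, i.e. `Q(o ∈ C_s) + Q(a ∉ C_s) · μ(o~a | M) ≤ 1`
(`Q = μ(·|s↮x)`); a consequence of `phi_one` (`… ≤ μ(o ∈ C_a ∪ C_s | {a,s}↮x) ≤ 1`).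
[cite: KozmaNitzan2024, Lemmas 1–2 (pp. 5–6)] -/
theorem ta_le_one (w : Sym2 V → unitInterval) (o a s x : V) :
    (prodBernoulli w).real ({ω : BondConfig V | ¬ (openGraph ω).Reachable s x} ∩ {ω | (openGraph ω).Reachable s o}) *
        (prodBernoulli w).real {ω : BondConfig V | (¬ (openGraph ω).Reachable s a ∧ ¬ (openGraph ω).Reachable s x) ∧
          ¬ (openGraph ω).Reachable a x} +
      (prodBernoulli w).real {ω : BondConfig V | ¬ (openGraph ω).Reachable s a ∧ ¬ (openGraph ω).Reachable s x} *
        (prodBernoulli w).real ({ω : BondConfig V | (¬ (openGraph ω).Reachable s a ∧ ¬ (openGraph ω).Reachable s x) ∧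
            ¬ (openGraph ω).Reachable a x} ∩ {ω | (openGraph ω).Reachable a o}) ≤
    (prodBernoulli w).real {ω : BondConfig V | ¬ (openGraph ω).Reachable s x} *
      (prodBernoulli w).real {ω : BondConfig V | (¬ (openGraph ω).Reachable s a ∧ ¬ (openGraph ω).Reachable s x) ∧
          ¬ (openGraph ω).Reachable a x} := by
  have key := phi_one w o a s x
  set μ := prodBernoulli w with hμ
  set R : Set (BondConfig V) := {ω | ¬ (openGraph ω).Reachable s x} with hR
  set D : Set (BondConfig V) := {ω | ¬ (openGraph ω).Reachable a x ∧ ¬ (openGraph ω).Reachable s x} with hD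
  set OD : Set (BondConfig V) := {ω | (openGraph ω).Reachable a o ∨ (openGraph ω).Reachable s o} with hOD
  set K : Set (BondConfig V) := {ω | ¬ (openGraph ω).Reachable s a ∧ ¬ (openGraph ω).Reachable s x} with hK
  set M : Set (BondConfig V) := {ω | (¬ (openGraph ω).Reachable s a ∧ ¬ (openGraph ω).Reachable s x) ∧
      ¬ (openGraph ω).Reachable a x} with hM
  set O : Set (BondConfig V) := {ω | (openGraph ω).Reachable s o} with hO
  set Oa : Set (BondConfig V) := {ω | (openGraph ω).Reachable a o} with hOa
  -- key : μ(R∩O)·μ(D)·μ(M) + μ(K)·μ(D)·μ(M∩Oa) ≤ μ(D∩OD)·μ(R)·μ(M)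
  have hDOD : μ.real (D ∩ OD) ≤ μ.real D := measureReal_mono Set.inter_subset_left
  have h1 : 0 ≤ μ.real R := measureReal_nonneg
  have h2 : 0 ≤ μ.real M := measureReal_nonneg
  have h3 : 0 ≤ μ.real D := measureReal_nonneg
  have h4 : 0 ≤ μ.real (R ∩ O) := measureReal_nonneg
  have h5 : 0 ≤ μ.real K := measureReal_nonneg
  have h6 : 0 ≤ μ.real (M ∩ Oa) := measureReal_nonneg
  have key' : (μ.real (R ∩ O) * μ.real M + μ.real K * μ.real (M ∩ Oa)) * μ.real D ≤
      (μ.real R * μ.real M) * μ.real D := by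
    have hh : μ.real (D ∩ OD) * μ.real R * μ.real M ≤ μ.real D * μ.real R * μ.real M := by
      apply mul_le_mul_of_nonneg_right _ h2
      exact mul_le_mul_of_nonneg_right hDOD h1
    nlinarith [key, hh]
  by_cases hd : μ.real D = 0
  · -- then `M ⊆ D` has measure zero and both sides vanish
    have hM0 : μ.real M = 0 := by
      refine le_antisymm ?_ h2
      calc μ.real M ≤ μ.real D := by
            refine measureReal_mono ?_
            intro ω hω; simp only [hM, hD, Set.mem_setOf_eq] at hω ⊢; exact ⟨hω.2, hω.1.2⟩
        _ = 0 := hd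
    have hMOa : μ.real (M ∩ Oa) = 0 :=
      le_antisymm (hM0 ▸ measureReal_mono Set.inter_subset_left) measureReal_nonneg
    rw [hM0, hMOa]; simp
  · have hdpos : 0 < μ.real D := lt_of_le_of_ne h3 (Ne.symm hd)
    exact le_of_mul_le_mul_right key' hdpos

/-- **`o`-blind reduction of (II) (constant `κ_M`).**  For every up-family `𝒰` of vertex sets: if (II) holds for the
`o`-blind event `Eₒ = {C_s ∖ {o} ∈ 𝒰}` (the family `{W : W ∖ {o} ∈ 𝒰}` is again up-closed), then (II) holds for
`E = {C_s ∈ 𝒰}`:  `μ(R∩O)·μ(R∩E)·μ(M) + μ(M∩{a~o})·μ(R∩A∩E)·μ(R) ≤ μ(R∩O∩E)·μ(R)·μ(M) + μ(M∩{a~o})·μ(R∩A)·μ(R∩E)`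
(`R = {s↮x}`, `O = {s~o}`, `A = {s~a}`, `M = {s↮a}∩{s↮x}∩{a↮x}`).  [The difference `E ∖ Eₒ` lies inside `O`, and its
contribution is `≥ 0` by `ta_le_one`.]  So the conjectured (II) need only be proved for up-families that do not see
`o`.  [cite: VandenbergHaggstromKahn2005, Thm. 1.2 (p. 5)] [cite: KozmaNitzan2024, §3 (pp. 7–12)] -/
theorem oblind_reduction (w : Sym2 V → unitInterval) (o a s x : V) (𝒰 : Set (Set V))
    (hU : ∀ W ∈ 𝒰, ∀ W' : Set V, W ⊆ W' → W' ∈ 𝒰)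
    (h : (prodBernoulli w).real ({ω : BondConfig V | ¬ (openGraph ω).Reachable s x} ∩ {ω | (openGraph ω).Reachable s o}) *
          (prodBernoulli w).real ({ω : BondConfig V | ¬ (openGraph ω).Reachable s x} ∩
            {ω | ({v | (openGraph ω).Reachable s v} \ {o}) ∈ 𝒰}) *
          (prodBernoulli w).real {ω : BondConfig V | (¬ (openGraph ω).Reachable s a ∧ ¬ (openGraph ω).Reachable s x) ∧
            ¬ (openGraph ω).Reachable a x} +
        (prodBernoulli w).real ({ω : BondConfig V | (¬ (openGraph ω).Reachable s a ∧ ¬ (openGraph ω).Reachable s x) ∧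
              ¬ (openGraph ω).Reachable a x} ∩ {ω | (openGraph ω).Reachable a o}) *
          (prodBernoulli w).real ({ω : BondConfig V | ¬ (openGraph ω).Reachable s x} ∩
            ({ω | (openGraph ω).Reachable s a} ∩ {ω | ({v | (openGraph ω).Reachable s v} \ {o}) ∈ 𝒰})) *
          (prodBernoulli w).real {ω : BondConfig V | ¬ (openGraph ω).Reachable s x} ≤
      (prodBernoulli w).real ({ω : BondConfig V | ¬ (openGraph ω).Reachable s x} ∩
            ({ω | (openGraph ω).Reachable s o} ∩ {ω | ({v | (openGraph ω).Reachable s v} \ {o}) ∈ 𝒰})) *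
          (prodBernoulli w).real {ω : BondConfig V | ¬ (openGraph ω).Reachable s x} *
          (prodBernoulli w).real {ω : BondConfig V | (¬ (openGraph ω).Reachable s a ∧ ¬ (openGraph ω).Reachable s x) ∧
            ¬ (openGraph ω).Reachable a x} +
        (prodBernoulli w).real ({ω : BondConfig V | (¬ (openGraph ω).Reachable s a ∧ ¬ (openGraph ω).Reachable s x) ∧
              ¬ (openGraph ω).Reachable a x} ∩ {ω | (openGraph ω).Reachable a o}) *
          (prodBernoulli w).real ({ω : BondConfig V | ¬ (openGraph ω).Reachable s x} ∩ {ω | (openGraph ω).Reachable s a}) *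
          (prodBernoulli w).real ({ω : BondConfig V | ¬ (openGraph ω).Reachable s x} ∩
            {ω | ({v | (openGraph ω).Reachable s v} \ {o}) ∈ 𝒰})) :
    (prodBernoulli w).real ({ω : BondConfig V | ¬ (openGraph ω).Reachable s x} ∩ {ω | (openGraph ω).Reachable s o}) *
          (prodBernoulli w).real ({ω : BondConfig V | ¬ (openGraph ω).Reachable s x} ∩
            {ω | {v | (openGraph ω).Reachable s v} ∈ 𝒰}) *
          (prodBernoulli w).real {ω : BondConfig V | (¬ (openGraph ω).Reachable s a ∧ ¬ (openGraph ω).Reachable s x) ∧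
            ¬ (openGraph ω).Reachable a x} +
        (prodBernoulli w).real ({ω : BondConfig V | (¬ (openGraph ω).Reachable s a ∧ ¬ (openGraph ω).Reachable s x) ∧
              ¬ (openGraph ω).Reachable a x} ∩ {ω | (openGraph ω).Reachable a o}) *
          (prodBernoulli w).real ({ω : BondConfig V | ¬ (openGraph ω).Reachable s x} ∩
            ({ω | (openGraph ω).Reachable s a} ∩ {ω | {v | (openGraph ω).Reachable s v} ∈ 𝒰})) *
          (prodBernoulli w).real {ω : BondConfig V | ¬ (openGraph ω).Reachable s x} ≤
      (prodBernoulli w).real ({ω : BondConfig V | ¬ (openGraph ω).Reachable s x} ∩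
            ({ω | (openGraph ω).Reachable s o} ∩ {ω | {v | (openGraph ω).Reachable s v} ∈ 𝒰})) *
          (prodBernoulli w).real {ω : BondConfig V | ¬ (openGraph ω).Reachable s x} *
          (prodBernoulli w).real {ω : BondConfig V | (¬ (openGraph ω).Reachable s a ∧ ¬ (openGraph ω).Reachable s x) ∧
            ¬ (openGraph ω).Reachable a x} +
        (prodBernoulli w).real ({ω : BondConfig V | (¬ (openGraph ω).Reachable s a ∧ ¬ (openGraph ω).Reachable s x) ∧
              ¬ (openGraph ω).Reachable a x} ∩ {ω | (openGraph ω).Reachable a o}) *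
          (prodBernoulli w).real ({ω : BondConfig V | ¬ (openGraph ω).Reachable s x} ∩ {ω | (openGraph ω).Reachable s a}) *
          (prodBernoulli w).real ({ω : BondConfig V | ¬ (openGraph ω).Reachable s x} ∩
            {ω | {v | (openGraph ω).Reachable s v} ∈ 𝒰}) := by
  set μ := prodBernoulli w with hμ
  set R : Set (BondConfig V) := {ω | ¬ (openGraph ω).Reachable s x} with hR
  set K : Set (BondConfig V) := {ω | ¬ (openGraph ω).Reachable s a ∧ ¬ (openGraph ω).Reachable s x} with hK
  set M : Set (BondConfig V) := {ω | (¬ (openGraph ω).Reachable s a ∧ ¬ (openGraph ω).Reachable s x) ∧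
      ¬ (openGraph ω).Reachable a x} with hM
  set O : Set (BondConfig V) := {ω | (openGraph ω).Reachable s o} with hO
  set A : Set (BondConfig V) := {ω | (openGraph ω).Reachable s a} with hA
  set Oa : Set (BondConfig V) := {ω | (openGraph ω).Reachable a o} with hOa
  set E : Set (BondConfig V) := {ω | {v | (openGraph ω).Reachable s v} ∈ 𝒰} with hE
  set Eo : Set (BondConfig V) := {ω | ({v | (openGraph ω).Reachable s v} \ {o}) ∈ 𝒰} with hEo
  -- `Eo ⊆ E` (up-closedness) and `E \ Eo ⊆ O`
  have hsub : Eo ⊆ E := by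
    intro ω hω
    simp only [hEo, hE, Set.mem_setOf_eq] at hω ⊢
    exact hU _ hω _ Set.sdiff_subset
  have hN : E \ Eo ⊆ O := by
    intro ω hω
    simp only [hEo, hE, hO, Set.mem_sdiff, Set.mem_setOf_eq] at hω ⊢
    by_contra hso
    apply hω.2
    have : ({v | (openGraph ω).Reachable s v} \ {o} : Set V) = {v | (openGraph ω).Reachable s v} := by
      ext v
      simp only [Set.mem_sdiff, Set.mem_setOf_eq, Set.mem_singleton_iff]
      constructor
      · rintro ⟨hv, _⟩; exact hv
      · intro hv; exact ⟨hv, fun hvo => hso (hvo ▸ hv)⟩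
    rw [this]; exact hω.1
  -- side condition
  have hRA : R ∩ Aᶜ = K := by
    ext ω; simp only [hR, hA, hK, Set.mem_inter_iff, Set.mem_compl_iff, Set.mem_setOf_eq]; tauto
  have ht : μ.real (R ∩ O) * μ.real M + μ.real (R ∩ Aᶜ) * μ.real (M ∩ Oa) ≤ μ.real R * μ.real M := by
    rw [hRA]; exact ta_le_one w o a s x
  have hcore := oblind_core μ R O A E Eo hsub hN (measureReal_nonneg (s := M ∩ Oa)) ht
  -- reshape the hypothesis and the goal to the shape of `oblind_core`
  have h' : μ.real (R ∩ O) * μ.real (R ∩ Eo) * μ.real M + μ.real (M ∩ Oa) * μ.real (R ∩ (A ∩ Eo)) * μ.real R ≤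
      μ.real (R ∩ (O ∩ Eo)) * μ.real R * μ.real M + μ.real (M ∩ Oa) * μ.real (R ∩ A) * μ.real (R ∩ Eo) := h
  have := hcore h'
  exact this

end KNGoodTwoMark

end Summit.CriticalPhenomena.PercolationContinuityZ3.Theorems
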